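import Mathlib.LinearAlgebra.Trace
import Literature.Computability.AlgebraicComplexity.QuantumFunctionalsUpper
import Literature.NumberTheory.DiophantineGeometry.SymmetricGroupRepsYoungSymmetrizerMulSelfProofs
import Literature.RepresentationTheory.FiniteGroups.SymmetricGroupIsotypic
import HarnessLib

/-!
# Schur–Weyl vanishing of the isotypic character sums — discharge of `schurWeyl_isotypicSum_eq_zero`

Topic `Literature/Computability/AlgebraicComplexity`; sibling proof file of
`QuantumFunctionalsUpper.lean`, which vendors as the named fact `schurWeyl_isotypicSum_eq_zero` the
vanishing half of Schur–Weyl duality used by Christandl–Vrana–Zuiddam (J. Amer. Math. Soc. 36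
(2023), §3.1, display (sw): "`V^{⊗n} ≅ ⊕_{λ ⊢ n} S_λ(V) ⊗ [λ]`, where `[λ]` is an irreducible
`S_n`-module and `S_λ(V)` is an irreducible `GL(V)`-module if `ℓ(λ) ≤ d` and `0` otherwise"): in
the coordinate model of that file, `∑_{π ∈ S_n} χ_λ(π) (π ·ⱼ u) = 0` on the `j`-th leg space as soon as
the `j`-th index set has fewer than `ℓ(λ)` elements (`j = 1, 2, 3`). This file PROVES it
(`schurWeyl_isotypicSum_eq_zero_holds`).

## Proof

Write `A = ℂ[S_n]`, `c = c_λ = a_λ b_λ` (Young symmetrizer of the row-reading tableau,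
`Literature.NumberTheory.DiophantineGeometry.youngSymmetrizer`), `L = A c` (the Specht module
`spechtIdeal ℂ λ`) and `χ = χ_λ` for its character (`spechtCharacter ℂ λ`, the trace of left
multiplication). The argument is the standard one behind (sw) (Fulton–Harris, Lemma 4.26 and
Thm. 6.3 (1); Serre §2.6 for the projector `∑ χ(g⁻¹) g`):

1. `c² = N c` with `N = (c²)_1 ≠ 0` (tree: `youngSymmetrizer_sq`,
   `coeff_sq_youngSymmetrizer_mul_finrank_spechtIdeal`, i.e. `N · dim L = n!`), so `e = N⁻¹ c` is an
   idempotent generator of `L` and `x e = x` on `L`.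
2. `χ(g) = tr_L(x ↦ g x) = tr_A(x ↦ g x e) = ∑_h e(h⁻¹ g⁻¹ h)` (`character_ofModule_span_singleton`;
   `tr(r ∘ f) = tr(f ∘ r)` for `r = (· e) : A → L` and `f = (g ·) : L → A`, then the matrix of
   `x ↦ g x e` in the basis `S_n`).
3. For EVERY representation `ρ` of `S_n` (any universe), reindexing `g = h y h⁻¹` gives
   `∑_g χ(g⁻¹) ρ(g) = N⁻¹ ∑_h ρ(h) ρ(c) ρ(h)⁻¹`, hence `ρ(c) = 0 ⇒ ∑_g χ(g⁻¹) ρ(g) = 0`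
   (`sum_character_inv_smul_eq_zero`).
4. For the leg action `(π ·₁ u)(a, b, c) = u(a ∘ π, b, c)` (a representation `ρ` of `S_n`) with
   `|ι| < ℓ(λ)`: every `a : Fin n → ι` repeats a value at two positions `i ≠ j` of the first column
   of the tableau (tree: `exists_ne_colOf_eq_apply_eq`), the transposition `τ = (i j)` lies in `C_λ`
   (`swap_mem_colStabilizer`) with `τ b_λ = -b_λ` (`of_mul_colAntisymmetrizer`) and `a ∘ τ = a`, so
   `(b_λ u)(a, ·, ·) = (τ b_λ u)(a, ·, ·) = -(b_λ u)(a, ·, ·) = 0`; thus `ρ(b_λ) = 0` and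
   `ρ(c_λ) = ρ(a_λ) ρ(b_λ) = 0`.
5. `χ_λ(π⁻¹) = χ_λ(π)` (tree: `spechtCharacter_inv`) identifies `∑ χ(π⁻¹) ρ(π) u` with
   `isotypicSum₁ λ u` (`isotypicSum₁_eq_zero_of_card_lt`); the second and third legs reduce to the
   first by exchanging arguments (`isotypicSum₂_eq_isotypicSum₁`, `isotypicSum₃_eq_isotypicSum₁`).

Theorems only (no new definitions): the leg representation is built locally inside
`isotypicSum₁_eq_zero_of_card_lt`.

## References

* M. Christandl, P. Vrana, J. Zuiddam, *Universal points in the asymptotic spectrum of tensors*,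
  J. Amer. Math. Soc. 36 (2023) 31–79 = arXiv:1709.07851v3, §3.1, display (sw).
  [ChristandlVranaZuiddam2023]
* W. Fulton, J. Harris, *Representation Theory. A First Course*, GTM 129 (1991), Lemma 4.26,
  Thm. 6.3 (1). [FultonHarrisGTM129]
* J.-P. Serre, *Linear Representations of Finite Groups*, GTM 42 (1977), §2.6 Thm. 8.
  [SerreLinearRepresentations1977]

## Mathlib and tree

Mathlib: `Representation.ofModule'`, `Representation.asAlgebraHom`, `Representation.character`,
`LinearMap.trace_comp_comm'`, `LinearMap.trace_eq_matrix_trace`, `MonoidAlgebra.basis`,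
`MonoidAlgebra.coeff_single_mul_apply`, `Fintype.sum_equiv`, `MulAut.conj`. Tree:
`youngSymmetrizer_sq`, `coeff_sq_youngSymmetrizer_mul_finrank_spechtIdeal`,
`of_mul_colAntisymmetrizer`, `swap_mem_colStabilizer`, `exists_ne_colOf_eq_apply_eq`
(`Literature/NumberTheory/DiophantineGeometry`), `spechtCharacter_inv`
(`Literature/RepresentationTheory/FiniteGroups/SymmetricGroupIsotypic.lean`).
-/

noncomputable section

open scoped BigOperators

namespace Literature.Computability.AlgebraicComplexity

open Literature.NumberTheory.DiophantineGeometry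

universe u

/-! ## Characters of principal left ideals of a group algebra -/

section LeftIdeal

variable {k : Type*} [Field k] {G : Type*} [Group G] [Fintype G]

/-- The trace of `x ↦ g x e` on the group algebra `k[G]` is `∑_h e(h⁻¹ g⁻¹ h)`: in the basis `G`
the diagonal entry at `h` is the coefficient of `h` in `g h e`. [folklore] -/
theorem trace_mulLeft_comp_mulRight (g : G) (e : MonoidAlgebra k G) :
    LinearMap.trace k _ (LinearMap.mulLeft k (MonoidAlgebra.single g (1 : k)) ∘ₗ
      LinearMap.mulRight k e) = ∑ h : G, e.coeff (h⁻¹ * g⁻¹ * h) := by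
  classical
  rw [LinearMap.trace_eq_matrix_trace k (MonoidAlgebra.basis G k), Matrix.trace]
  refine Finset.sum_congr rfl fun h _ => ?_
  rw [Matrix.diag_apply, LinearMap.toMatrix_apply, MonoidAlgebra.basis_apply, LinearMap.comp_apply,
    LinearMap.mulRight_apply, LinearMap.mulLeft_apply]
  change (MonoidAlgebra.single g 1 * (MonoidAlgebra.single h 1 * e)).coeff h = _
  rw [← mul_assoc, MonoidAlgebra.single_mul_single, one_mul, MonoidAlgebra.coeff_single_mul_apply,
    one_mul, mul_inv_rev]

/-- **Character of a principal left ideal with quasi-idempotent generator.** If `c² = N c` with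
`N ≠ 0` in `k[G]`, the character of the left regular action of `G` on `L = k[G] c` is
`χ_L(g) = N⁻¹ ∑_{h ∈ G} c(h⁻¹ g⁻¹ h)`: with the idempotent `e = N⁻¹ c`, `L = k[G] e`, and
`tr_L(g ·) = tr_{k[G]}(x ↦ g x e)` (Fulton–Harris, proof of Lemma 4.26, the trace of right
multiplication computed on `A` and on `V_λ`; Serre §2.6). [folklore] -/
theorem character_ofModule_span_singleton (c : MonoidAlgebra k G) {N : k} (hN : N ≠ 0)
    (hc : c * c = N • c) (g : G) :
    (Representation.ofModule' (k := k) (G := G)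
        ↥(Ideal.span ({c} : Set (MonoidAlgebra k G)))).character g =
      N⁻¹ * ∑ h : G, c.coeff (h⁻¹ * g⁻¹ * h) := by
  set L : Ideal (MonoidAlgebra k G) := Ideal.span {c} with hL
  set e : MonoidAlgebra k G := N⁻¹ • c with he
  have hce : c * e = c := by
    rw [he, mul_smul_comm, hc, smul_smul, inv_mul_cancel₀ hN, one_smul]
  have hxe : ∀ x ∈ L, x * e = x := fun x hx => by
    obtain ⟨a, rfl⟩ := Ideal.mem_span_singleton'.1 hx
    rw [mul_assoc, hce]
  have hmem : ∀ x : MonoidAlgebra k G, x * e ∈ L := fun x => by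
    rw [he, mul_smul_comm]
    exact L.smul_of_tower_mem _ (Ideal.mem_span_singleton'.2 ⟨x, rfl⟩)
  -- `r : A → L`, `x ↦ x e`, and `f : L → A`, `x ↦ g x`
  let r : MonoidAlgebra k G →ₗ[k] ↥L :=
    { toFun := fun x => ⟨x * e, hmem x⟩
      map_add' := fun x y => Subtype.ext (add_mul x y e)
      map_smul' := fun s x => Subtype.ext (smul_mul_assoc s x e) }
  let f : ↥L →ₗ[k] MonoidAlgebra k G :=
    LinearMap.mulLeft k (MonoidAlgebra.single g (1 : k)) ∘ₗ (L.subtype.restrictScalars k)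
  have hρ : Representation.ofModule' (k := k) (G := G) ↥L g = r ∘ₗ f := by
    refine LinearMap.ext fun x => Subtype.ext ?_
    change ((Representation.ofModule' (k := k) (G := G) ↥L g x : ↥L) : MonoidAlgebra k G) =
      MonoidAlgebra.single g 1 * (x : MonoidAlgebra k G) * e
    rw [mul_assoc, hxe _ x.2]
    simp [Representation.ofModule']
  have hfr : f ∘ₗ r = LinearMap.mulLeft k (MonoidAlgebra.single g (1 : k)) ∘ₗ
      LinearMap.mulRight k e := rfl
  rw [Representation.character, hρ, LinearMap.trace_comp_comm', hfr, trace_mulLeft_comp_mulRight,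
    Finset.mul_sum]
  refine Finset.sum_congr rfl fun h _ => ?_
  rw [he, MonoidAlgebra.coeff_smul, Finsupp.smul_apply, smul_eq_mul]

omit [Fintype G] in
/-- The algebra action of `x ∈ k[G]` in a representation `ρ` of a finite group is
`∑_{g ∈ G} x(g) ρ(g)`. Unfolding lemma. [folklore] -/
theorem asAlgebraHom_eq_sum_coeff_smul [Fintype G] {V : Type*} [AddCommMonoid V] [Module k V]
    (ρ : Representation k G V) (x : MonoidAlgebra k G) :
    ρ.asAlgebraHom x = ∑ g : G, x.coeff g • ρ g := by
  conv_lhs => rw [← MonoidAlgebra.sum_coeff_single x]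
  rw [Finsupp.sum_fintype _ _ (fun g => by simp), map_sum]
  simp [Representation.asAlgebraHom_single]

/-- **The isotypic sum of a principal left ideal vanishes where its generator acts by zero.** If
`c² = N c`, `N ≠ 0`, and `c` acts by zero in a representation `ρ` of `G` (on a module in any
universe), then `∑_{g ∈ G} χ_{k[G]c}(g⁻¹) ρ(g) = 0`: by `character_ofModule_span_singleton` and the
reindexing `g = h y h⁻¹`, `∑_g χ(g⁻¹) ρ(g) = N⁻¹ ∑_h ρ(h) ρ(c) ρ(h)⁻¹` (Serre §2.6, proof of Thm. 8:
`p = (n/g) ∑ χ(t)* ρ_t` is built from the action of the group algebra). [folklore] -/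
theorem sum_character_inv_smul_eq_zero (c : MonoidAlgebra k G) {N : k} (hN : N ≠ 0)
    (hc : c * c = N • c) {V : Type*} [AddCommGroup V] [Module k V] (ρ : Representation k G V)
    (hρ : ρ.asAlgebraHom c = 0) :
    ∑ g : G, (Representation.ofModule' (k := k) (G := G)
        ↥(Ideal.span ({c} : Set (MonoidAlgebra k G)))).character g⁻¹ • ρ g = 0 := by
  simp_rw [character_ofModule_span_singleton c hN hc, inv_inv, Finset.mul_sum, Finset.sum_smul]
  rw [Finset.sum_comm]
  refine Finset.sum_eq_zero fun h _ => ?_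
  -- the inner sum over `g`, for fixed `h`, reindexed by `g = h y h⁻¹`
  have key : ∑ g : G, (N⁻¹ * c.coeff (h⁻¹ * g * h)) • ρ g =
      N⁻¹ • (ρ h * ρ.asAlgebraHom c * ρ h⁻¹) := by
    simp_rw [mul_smul]
    rw [← Finset.smul_sum, asAlgebraHom_eq_sum_coeff_smul, Finset.mul_sum, Finset.sum_mul]
    congr 1
    refine Fintype.sum_equiv (MulAut.conj h⁻¹).toEquiv _ _ fun g => ?_
    rw [mul_smul_comm, smul_mul_assoc, ← map_mul, ← map_mul]
    simp only [MulEquiv.toEquiv_eq_coe, MulEquiv.coe_toEquiv, MulAut.conj_apply, inv_inv]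
    congr 2
    group
  rw [key, hρ, mul_zero, zero_mul, smul_zero]

end LeftIdeal

/-! ## The three isotypic character sums -/

section Legs

variable {ι κ μ : Type*} {n : ℕ}

/-- The second-leg character sum is the first-leg one after exchanging the first two arguments.
[folklore] -/
theorem isotypicSum₂_eq_isotypicSum₁ (lam : Nat.Partition n)
    (u : (Fin n → ι) → (Fin n → κ) → (Fin n → μ) → ℂ) :
    isotypicSum₂ lam u = fun a b c => isotypicSum₁ lam (fun b' a' c' => u a' b' c') b a c := by
  funext a b c
  simp only [isotypicSum₁, isotypicSum₂, Finset.sum_apply, Pi.smul_apply, permLegs₁_apply,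
    permLegs₂_apply]

/-- The third-leg character sum is the first-leg one after exchanging the first and third
arguments. [folklore] -/
theorem isotypicSum₃_eq_isotypicSum₁ (lam : Nat.Partition n)
    (u : (Fin n → ι) → (Fin n → κ) → (Fin n → μ) → ℂ) :
    isotypicSum₃ lam u = fun a b c => isotypicSum₁ lam (fun c' b' a' => u a' b' c') c b a := by
  funext a b c
  simp only [isotypicSum₁, isotypicSum₃, Finset.sum_apply, Pi.smul_apply, permLegs₁_apply,
    permLegs₃_apply]

/-- **Schur–Weyl vanishing on the first legs**: if `|ι| < ℓ(λ)` then
`∑_π χ_λ(π) (π ·₁ u) = 0` for every `u` (CVZ §3.1 (sw): `S_λ(V) = 0` unless `ℓ(λ) ≤ dim V`;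
Fulton–Harris Thm. 6.3 (1)). The leg action `(π ·₁ u)(a, b, c) = u(a ∘ π, b, c)` is a
representation `ρ` of `S_n`; every `a : Fin n → ι` repeats a value at two positions `i ≠ j` of the
first column of the tableau, `τ = (i j) ∈ C_λ` fixes `a` and `τ b_λ = -b_λ`, so
`(b_λ u)(a, ·, ·) = -(b_λ u)(a, ·, ·) = 0`; hence `ρ(c_λ) = ρ(a_λ) ρ(b_λ) = 0`, and
`sum_character_inv_smul_eq_zero` with `χ_λ(π⁻¹) = χ_λ(π)` gives the claim.
[cite: ChristandlVranaZuiddam2023, §3.1 (sw)] -/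
theorem isotypicSum₁_eq_zero_of_card_lt [Fintype ι] (lam : Nat.Partition n)
    (h : Fintype.card ι < Multiset.card lam.parts)
    (u : (Fin n → ι) → (Fin n → κ) → (Fin n → μ) → ℂ) : isotypicSum₁ lam u = 0 := by
  -- the leg action as a representation of `S_n`
  let ρ : Representation ℂ (Equiv.Perm (Fin n)) ((Fin n → ι) → (Fin n → κ) → (Fin n → μ) → ℂ) :=
    { toFun := fun π =>
        { toFun := permLegs₁ π
          map_add' := fun _ _ => rfl
          map_smul' := fun _ _ => rfl }
      map_one' := rfl
      map_mul' := fun _ _ => rfl }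
  have hρ : ∀ (π : Equiv.Perm (Fin n)) (v : (Fin n → ι) → (Fin n → κ) → (Fin n → μ) → ℂ),
      ρ π v = permLegs₁ π v := fun _ _ => rfl
  -- the column antisymmetrizer `b_λ` acts by zero (first-column pigeonhole)
  have hB : ρ.asAlgebraHom (colAntisymmetrizer ℂ lam) = 0 := by
    refine LinearMap.ext fun v => funext fun a => funext fun b => funext fun c => ?_
    obtain ⟨i, j, hij, hcol, ha⟩ := exists_ne_colOf_eq_apply_eq lam h a
    have haτ : a ∘ Equiv.swap i j = a := funext fun x => Equiv.apply_swap_eq_self ha x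
    -- `τ b_λ = -b_λ` in the representation
    have hτB : ρ (Equiv.swap i j) ∘ₗ ρ.asAlgebraHom (colAntisymmetrizer ℂ lam) =
        -ρ.asAlgebraHom (colAntisymmetrizer ℂ lam) := by
      rw [← Representation.asAlgebraHom_of, ← Module.End.mul_eq_comp, ← map_mul,
        of_mul_colAntisymmetrizer (swap_mem_colStabilizer lam hcol), map_smul,
        Equiv.Perm.sign_swap hij, Units.val_neg, Units.val_one, Int.cast_neg, Int.cast_one]
      exact neg_one_smul ℂ (ρ.asAlgebraHom (colAntisymmetrizer ℂ lam))
    have h1 : ρ.asAlgebraHom (colAntisymmetrizer ℂ lam) v a b c =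
        (ρ (Equiv.swap i j) ∘ₗ ρ.asAlgebraHom (colAntisymmetrizer ℂ lam)) v a b c := by
      rw [LinearMap.comp_apply, hρ, permLegs₁_apply, haτ]
    rw [hτB, LinearMap.neg_apply, Pi.neg_apply, Pi.neg_apply, Pi.neg_apply] at h1
    rw [LinearMap.zero_apply, Pi.zero_apply, Pi.zero_apply, Pi.zero_apply]
    have h2 : (2 : ℂ) * ρ.asAlgebraHom (colAntisymmetrizer ℂ lam) v a b c = 0 := by
      rw [two_mul]
      nth_rewrite 2 [h1]
      exact add_neg_cancel _
    exact (mul_eq_zero.mp h2).resolve_left two_ne_zero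
  -- hence so does the Young symmetrizer `c_λ = a_λ b_λ`
  have hC : ρ.asAlgebraHom (youngSymmetrizer ℂ lam) = 0 := by
    rw [youngSymmetrizer, map_mul, hB, mul_zero]
  -- `c_λ² = N c_λ` with `N ≠ 0` (`N · dim S^λ = n!`)
  set c := youngSymmetrizer ℂ lam with hcdef
  set N : ℂ := (c * c).coeff 1 with hNdef
  have hc : c * c = N • c := youngSymmetrizer_sq ℂ lam
  have hN : N ≠ 0 := fun h0 => by
    have hfact := coeff_sq_youngSymmetrizer_mul_finrank_spechtIdeal ℂ lam
    rw [← hcdef, ← hNdef, h0, zero_mul] at hfact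
    exact Nat.cast_ne_zero.2 (Nat.factorial_ne_zero n) hfact.symm
  -- the conjugation-sum identity, and `χ_λ(π⁻¹) = χ_λ(π)`
  have hvan := sum_character_inv_smul_eq_zero c hN hc ρ hC
  have hχ : ∀ π : Equiv.Perm (Fin n), (Representation.ofModule' (k := ℂ) (G := Equiv.Perm (Fin n))
      ↥(Ideal.span ({c} : Set (MonoidAlgebra ℂ (Equiv.Perm (Fin n)))))).character π⁻¹ =
      spechtCharacter ℂ lam π := fun π =>
    Literature.RepresentationTheory.FiniteGroups.spechtCharacter_inv lam π
  simp_rw [hχ] at hvan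
  have happ := LinearMap.congr_fun hvan u
  rw [LinearMap.sum_apply, LinearMap.zero_apply] at happ
  rw [isotypicSum₁_def]
  exact happ

end Legs

/-! ## The discharge -/

/-- **Discharge of the named fact `schurWeyl_isotypicSum_eq_zero`** (CVZ §3.1, display (sw):
"`S_λ(V)` is an irreducible `GL(V)`-module if `ℓ(λ) ≤ d` and `0` otherwise"; Fulton–Harris
Thm. 6.3 (1)): for each of the three leg actions, the `λ`-isotypic character sum
`∑_π χ_λ(π) (π ·ⱼ u)` vanishes identically when the `j`-th index set has fewer than `ℓ(λ)`
elements. [cite: ChristandlVranaZuiddam2023, §3.1 (sw)] -/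
theorem schurWeyl_isotypicSum_eq_zero_holds : schurWeyl_isotypicSum_eq_zero.{u} := by
  intro ι κ μ _ _ _ n lam u
  refine ⟨fun h => isotypicSum₁_eq_zero_of_card_lt lam h u, fun h => ?_, fun h => ?_⟩
  · rw [isotypicSum₂_eq_isotypicSum₁]
    funext a b c
    rw [isotypicSum₁_eq_zero_of_card_lt lam h]
    rfl
  · rw [isotypicSum₃_eq_isotypicSum₁]
    funext a b c
    rw [isotypicSum₁_eq_zero_of_card_lt lam h]
    rfl

end Literature.Computability.AlgebraicComplexity

end
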